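import Summits.PneNP.PneNP.Theorems.KarlinRubinMonotoneSufficesGreedyDefs
import Summits.PneNP.PneNP.Theorems.KarlinRubinMonotoneSufficesGreedySplit

/-!
# Crux `MonotoneSuffices` (stmt-PneNP-18026), the GREEDY general detector — part 4: locality of a trial

A trial reads the input only through (a) the edges AMONG its candidates — these determine the whole run
(`run_congr_inside`: pool membership of a candidate with respect to picks, which are candidates, is decided by
candidate–candidate edges) — and (b) the edges from NON-candidates to the picks — these determine the final
count (`card_verify_congr_outside`). With part 3 this gives the generic error bound of one trial
(`card_trialOut_le_of_forall`, `card_runsInto_and_le_of_forall`): an outside tail bound `b` valid for every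
possible pick set bounds the corresponding trial event by `b`, because the run outcomes are pairwise exclusive
inside-events.
-/

set_option linter.dupNamespace false -- `Summit.PneNP.PneNP.…`: summit = sub-problem name (D-0017 single-conjunct layout)

namespace Summit.PneNP.PneNP.Theorems.MonotoneSuffices.Greedy

open Finset
open Literature.Probability.RandomGraphs.PlantedClique

variable {n t M : ℕ}

/-! ### Inside edges of a vertex set -/

/-- A star edge `s(u,w)` with `u, w ∈ W` is inside `W`. [folklore] -/
theorem star_inside {W T : Finset (Fin n)} (hT : T ⊆ W) {u : Fin n} (hu : u ∈ W)
    {e : (⊤ : SimpleGraph (Fin n)).edgeSet}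
    (he : e ∈ (univ.filter fun e : (⊤ : SimpleGraph (Fin n)).edgeSet => ∃ w ∈ T, (e : Sym2 (Fin n)) = s(u, w))) :
    ∀ v ∈ (e : Sym2 (Fin n)), v ∈ W := by
  obtain ⟨w, hw, hew⟩ := (mem_filter.1 he).2
  intro v hv
  rw [hew, Sym2.mem_iff] at hv
  rcases hv with rfl | rfl
  · exact hu
  · exact hT hw

/-- A star edge `s(u,w)` with `u ∉ W` is not inside `W`. [folklore] -/
theorem star_not_inside {W T : Finset (Fin n)} {u : Fin n} (hu : u ∉ W)
    {e : (⊤ : SimpleGraph (Fin n)).edgeSet}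
    (he : e ∈ (univ.filter fun e : (⊤ : SimpleGraph (Fin n)).edgeSet => ∃ w ∈ T, (e : Sym2 (Fin n)) = s(u, w))) :
    ¬ ∀ v ∈ (e : Sym2 (Fin n)), v ∈ W := by
  obtain ⟨w, -, hew⟩ := (mem_filter.1 he).2
  intro h
  exact hu (h u (by rw [hew]; exact Sym2.mem_mk_left u w))

/-! ### The run reads only candidate–candidate edges -/

/-- `firstHit` depends on the target set only through the membership of the candidates. [folklore] -/
theorem firstHit_congr (c : Fin M → Fin n) {P P' : Finset (Fin n)} (h : ∀ m, c m ∈ P ↔ c m ∈ P') :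
    firstHit c P = firstHit c P' := by
  unfold firstHit
  have : (fun m => decide (c m ∈ P)) = fun m => decide (c m ∈ P') :=
    funext fun m => by rw [decide_eq_decide]; exact h m
  rw [this]

/-- Pool membership of a vertex of `W` with respect to picks inside `W` is decided by the edges inside `W`.
[folklore] -/
theorem mem_pool_congr_inside {W T : Finset (Fin n)} (hT : T ⊆ W) {u : Fin n} (hu : u ∈ W) {x x' : EdgeVec n}
    (h : ∀ e : (⊤ : SimpleGraph (Fin n)).edgeSet, (∀ v ∈ (e : Sym2 (Fin n)), v ∈ W) → x e = x' e) :
    u ∈ pool x T ↔ u ∈ pool x' T := by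
  rw [mem_pool, mem_pool]
  refine and_congr_right fun _ => forall₂_congr fun e he => ?_
  rw [h e (star_inside hT hu he)]

/-- **The run is decided by the candidate–candidate edges.** [folklore] -/
theorem run_congr_inside (c : Fin t → Fin M → Fin n) {x x' : EdgeVec n}
    (h : ∀ e : (⊤ : SimpleGraph (Fin n)).edgeSet, (∀ v ∈ (e : Sym2 (Fin n)), v ∈ candSet c) → x e = x' e) :
    ∀ i : ℕ, run x c i = run x' c i
  | 0 => by rw [run_zero, run_zero]
  | i + 1 => by
      by_cases hi : i < t
      · rw [run_succ_of_lt x c hi, run_succ_of_lt x' c hi, ← run_congr_inside c h i]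
        cases hr : run x c i with
        | none => rfl
        | some T =>
            have hT : T ⊆ candSet c := run_subset_candSet x c i hr
            simp only [Option.bind_some]
            rw [firstHit_congr (c ⟨i, hi⟩) (P' := pool x' T) fun m =>
              mem_pool_congr_inside hT (mem_candSet.2 ⟨⟨i, hi⟩, m, rfl⟩) h]
      · rw [run_succ_of_le x c (not_lt.1 hi), run_succ_of_le x' c (not_lt.1 hi), run_congr_inside c h i]

/-! ### The count reads only non-candidate edges -/

/-- **The verification count is decided by the edges NOT inside `W`** (for picks `T ⊆ W`, counting over
vertices outside `W' ⊇ W`). [folklore] -/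
theorem card_verify_congr_outside {W W' T : Finset (Fin n)} (hT : T ⊆ W) (hW : W ⊆ W') {x x' : EdgeVec n}
    (h : ∀ e : (⊤ : SimpleGraph (Fin n)).edgeSet, (¬ ∀ v ∈ (e : Sym2 (Fin n)), v ∈ W) → x e = x' e) :
    #((univ \ W').filter (AdjAll x T)) = #((univ \ W').filter (AdjAll x' T)) := by
  have _ := hT
  refine congrArg card (filter_congr fun u hu => ?_)
  have huW : u ∉ W := fun h' => (mem_sdiff.1 hu).2 (hW h')
  refine forall₂_congr fun e he => ?_
  rw [h e (star_not_inside (T := T) huW he)]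

/-! ### Generic error bounds of one trial -/

/-- **Null-type bound.** If for every possible pick set `T` (a `t`-subset of the candidates) the inputs with
`θ ≤ #{u ∉ candidates : u ~ T}` number at most `b`, then the inputs accepted by the trial number at most `b`.
[folklore] -/
theorem card_trialOut_le_of_forall (c : Fin t → Fin M → Fin n) (θ b : ℕ)
    (hb : ∀ T ⊆ candSet c, #T = t →
      #((univ : Finset (EdgeVec n)).filter fun x => θ ≤ #((univ \ candSet c).filter (AdjAll x T))) ≤ b) :
    #((univ : Finset (EdgeVec n)).filter fun x => trialOut x c θ = true) ≤ b := by
  classical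
  set F : Finset (⊤ : SimpleGraph (Fin n)).edgeSet := univ.filter fun e => ∀ v ∈ (e : Sym2 (Fin n)), v ∈ candSet c
    with hF
  have hmemF : ∀ e : (⊤ : SimpleGraph (Fin n)).edgeSet, e ∈ F ↔ ∀ v ∈ (e : Sym2 (Fin n)), v ∈ candSet c := by
    intro e; simp [hF]
  refine le_trans (card_le_card ?_) (card_filter_exists_and_le (α := (⊤ : SimpleGraph (Fin n)).edgeSet)
    ((candSet c).powersetCard t) F (fun T x => run x c t = some T)
    (fun T x => θ ≤ #((univ \ candSet c).filter (AdjAll x T))) b ?_ ?_ ?_ ?_)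
  · -- the accepted inputs have such a pick set
    intro x hx
    rw [mem_filter] at hx ⊢
    obtain ⟨T, hT, hθ⟩ := (trialOut_eq_true_iff x c θ).1 hx.2
    exact ⟨mem_univ _, T, mem_powersetCard.2 ⟨run_subset_candSet x c t hT, card_of_run_eq_some x c le_rfl hT⟩, hT, hθ⟩
  · intro T _ x x' hxx'
    rw [run_congr_inside c (x := x) (x' := x') fun e he => hxx' e ((hmemF e).2 he)]
  · intro T hT x x' hxx'
    have hTW : T ⊆ candSet c := (mem_powersetCard.1 hT).1
    rw [card_verify_congr_outside hTW subset_rfl (x := x) (x' := x') fun e he => hxx' e (fun h' => he ((hmemF e).1 h'))]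
  · intro T _ T' _ x h h'
    rw [h] at h'
    exact Option.some_injective _ h'
  · intro T hT
    exact hb T (mem_powersetCard.1 hT).1 (mem_powersetCard.1 hT).2

/-- **Planted-type bound.** For a vertex set `A` and outside-events `Q T` (depending only on edges not inside the
candidate set, each with at most `b` inputs over the `t`-subsets `T ⊆ A` of the candidates): the inputs `z` whose
planted version `plant A z` runs into some `T ⊆ A` with `Q T z` number at most `b`. [folklore] -/
theorem card_runsInto_and_le_of_forall (c : Fin t → Fin M → Fin n) (A : Finset (Fin n))
    (Q : Finset (Fin n) → EdgeVec n → Prop) [∀ T, DecidablePred (Q T)] (b : ℕ)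
    (hQ : ∀ T ⊆ candSet c, ∀ z z' : EdgeVec n,
      (∀ e : (⊤ : SimpleGraph (Fin n)).edgeSet, (¬ ∀ v ∈ (e : Sym2 (Fin n)), v ∈ candSet c) → z e = z' e) → (Q T z ↔ Q T z'))
    (hb : ∀ T ⊆ candSet c, T ⊆ A → #T = t → #((univ : Finset (EdgeVec n)).filter (Q T)) ≤ b) :
    #((univ : Finset (EdgeVec n)).filter fun z => ∃ T ⊆ A, run (plant A z) c t = some T ∧ Q T z) ≤ b := by
  classical
  set F : Finset (⊤ : SimpleGraph (Fin n)).edgeSet := univ.filter fun e => ∀ v ∈ (e : Sym2 (Fin n)), v ∈ candSet c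
    with hF
  have hmemF : ∀ e : (⊤ : SimpleGraph (Fin n)).edgeSet, e ∈ F ↔ ∀ v ∈ (e : Sym2 (Fin n)), v ∈ candSet c := by
    intro e; simp [hF]
  refine le_trans (card_le_card ?_) (card_filter_exists_and_le (α := (⊤ : SimpleGraph (Fin n)).edgeSet)
    (((candSet c).powersetCard t).filter fun T => T ⊆ A) F (fun T z => run (plant A z) c t = some T) Q b ?_ ?_ ?_ ?_)
  · intro z hz
    rw [mem_filter] at hz ⊢
    obtain ⟨T, hTA, hT, hQT⟩ := hz.2
    refine ⟨mem_univ _, T, mem_filter.2 ⟨mem_powersetCard.2 ⟨run_subset_candSet _ c t hT,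
      card_of_run_eq_some _ c le_rfl hT⟩, hTA⟩, hT, hQT⟩
  · intro T _ z z' hzz'
    rw [run_congr_inside c (x := plant A z) (x' := plant A z') fun e he => by
      simp only [plant]; rw [hzz' e ((hmemF e).2 he)]]
  · intro T hT z z' hzz'
    exact hQ T (mem_powersetCard.1 (mem_filter.1 hT).1).1 z z' fun e he => hzz' e fun h' => he ((hmemF e).1 h')
  · intro T _ T' _ z h h'
    rw [h] at h'
    exact Option.some_injective _ h'
  · intro T hT
    obtain ⟨hT1, hT2⟩ := mem_filter.1 hT
    exact hb T (mem_powersetCard.1 hT1).1 hT2 (mem_powersetCard.1 hT1).2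

end Summit.PneNP.PneNP.Theorems.MonotoneSuffices.Greedy

namespace Summit.PneNP.PneNP.Theorems.MonotoneSuffices.Greedy

open Finset

/-- Registered sub-goal `greedy_locality` of stmt-PneNP-18026 (greedy detector, part 4): the null-type bound of
one trial, exported verbatim. [folklore] -/
theorem greedy_locality :
    ∀ {n t M : ℕ} (c : Fin t → Fin M → Fin n) (θ b : ℕ), (∀ T ⊆ Summit.PneNP.PneNP.Theorems.MonotoneSuffices.Greedy.candSet c, #T = t → #((Finset.univ : Finset (Literature.Probability.RandomGraphs.PlantedClique.EdgeVec n)).filter fun x => θ ≤ #((Finset.univ \ Summit.PneNP.PneNP.Theorems.MonotoneSuffices.Greedy.candSet c).filter (Summit.PneNP.PneNP.Theorems.MonotoneSuffices.Greedy.AdjAll x T))) ≤ b) → #((Finset.univ : Finset (Literature.Probability.RandomGraphs.PlantedClique.EdgeVec n)).filter fun x => Summit.PneNP.PneNP.Theorems.MonotoneSuffices.Greedy.trialOut x c θ = true) ≤ b :=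
  fun c θ b hb => card_trialOut_le_of_forall c θ b hb

end Summit.PneNP.PneNP.Theorems.MonotoneSuffices.Greedy
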